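import Literature.Probability.RandomPlanarGeometry.CritPercSLESimplePathProofs
import Literature.Probability.RandomPlanarGeometry.RohdeSchrammCor35Proofs
import HarnessLib

/-!
# Rohde–Schramm's Thm. 6.1 — the SLE_κ trace is a simple path for `κ ≤ 4` — discharged

Topic `Probability/RandomPlanarGeometry`; proof-only file (no definition, no new named fact).
The named fact `Literature.Probability.RandomPlanarGeometry.ae_isSimpleTrace_sleTrace_of_le_four`
(`CritPercSLE.lean`; S. Rohde, O. Schramm, *Basic properties of SLE*, Ann. of Math. 161 (2005),
Thm. 6.1, pp. 901–902: "In the case `κ ∈ [0, 4]`, the SLE_κ trace `γ` is a.s. a simple path and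
`γ[0, ∞) ⊂ ℍ ∪ {0}` a.s."; here `0 < κ ≤ 4`, the trace of the canonical SLE_κ being
`Loewner.IsSimpleTrace` almost surely) is discharged:

* `ae_isSimpleTrace_sleTrace_of_le_four_holds` — the printed proof of Thm. 6.1, formalised in
  `CritPercSLESimplePath.lean` / `CritPercSLESimplePathProofs.lean` (Lemma 6.2: for `κ ≤ 4` no real
  point is swallowed, `sle_swallowingTime_ofReal_eq_top_holds` = Lawler (2005) Prop. 6.8; the
  Markov shift `ĝ_t = g_{t+s} ∘ g_s⁻¹(· + ξ(s)) - ξ(s)` of Prop. 2.1 (ii) over rational `s`; the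
  strict growth of the hulls), left one stochastic input, the existence of the trace (Thm. 5.1,
  the named fact `hasSLETrace_of_ne_eight`): `ae_isSimpleTrace_sleTrace_of_le_four_of_hasSLETrace_fact`.
  That input is now a theorem of the tree, `hasSLETrace_of_ne_eight_holds`
  (`RohdeSchrammCor35Proofs.lean`: Cor. 3.5 `RohdeSchramm2005_cor35_holds` ⇒ Thm. 3.6
  `RohdeSchramm2005_thm36_holds` ⇒ Thm. 5.1 by the deterministic criterion Thm. 4.1), and the
  composition closes Thm. 6.1 unconditionally;
* `ae_isSimpleTrace_sleTrace_of_le_four_apply` — the same with the hypotheses `0 < κ`, `κ ≤ 4`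
  explicit, for consumers.

## References

* S. Rohde, O. Schramm, *Basic properties of SLE*, Ann. of Math. 161 (2005) 883–924
  (arXiv:math/0106036): Thm. 6.1 and Lemma 6.2 (pp. 901–902), Thm. 5.1 (p. 900), Thm. 3.6,
  Cor. 3.5 (p. 894), Prop. 2.1 (ii).
* G. F. Lawler, *Conformally Invariant Processes in the Plane*, AMS (2005), Prop. 6.8, Prop. 6.9
  (p. 150).
-/

noncomputable section

open MeasureTheory
open scoped NNReal

namespace Literature.Probability.RandomPlanarGeometry

variable {κ : ℝ≥0}

/-- **Rohde–Schramm (2005), Thm. 6.1, holds**: for `0 < κ ≤ 4` the trace of the canonical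
chordal SLE_κ is almost surely a simple path (`Loewner.IsSimpleTrace (sleTrace κ ω)` for
`preWienerMeasure`-a.e. `ω`). The printed proof (Lemma 6.2 + the Markov property at rational
times + strict growth of the hulls, `ae_isSimpleTrace_sleTrace_of_le_four_of_hasSLETrace_fact`)
fed with the trace theorem Thm. 5.1, now proved (`hasSLETrace_of_ne_eight_holds`, from Cor. 3.5
`RohdeSchramm2005_cor35_holds`). [cite: RohdeSchramm2005, Thm 6.1] -/
theorem ae_isSimpleTrace_sleTrace_of_le_four_holds : ae_isSimpleTrace_sleTrace_of_le_four (κ := κ) :=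
  ae_isSimpleTrace_sleTrace_of_le_four_of_hasSLETrace_fact hasSLETrace_of_ne_eight_holds

/-- **Rohde–Schramm (2005), Thm. 6.1**, with explicit hypotheses: if `0 < κ ≤ 4` then
`preWienerMeasure`-almost every SLE_κ trace is a simple path in `ℍ ∪ {0}`
(`Loewner.IsSimpleTrace`). [cite: RohdeSchramm2005, Thm 6.1] -/
theorem ae_isSimpleTrace_sleTrace_of_le_four_apply (h0 : 0 < κ) (h4 : κ ≤ 4) :
    ∀ᵐ ω ∂Process.preWienerMeasure, Loewner.IsSimpleTrace (sleTrace κ ω) :=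
  ae_isSimpleTrace_sleTrace_of_le_four_holds h0 h4

end Literature.Probability.RandomPlanarGeometry
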